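import Mathlib
import HarnessLib

/-!
# Markman 2025 §8.5 — the SIGN RULE (8.5.1) for conjugating the `HT^*`-action by the main anti-automorphism `τ`,
# `(α, β, γ)* = (−α, β, −γ)`, the involution `ι` of Remark 8.5.4, and the UNIPOTENT PROJECTION of Remark 8.5.3,
# AS PRINTED: the arithmetic and linear algebra, kernel-checked

E. Markman: [M] *Cycles on abelian 2n-folds of Weil type from secant sheaves on abelian n-folds*,
arXiv:2502.03415 **v2** (2025-06-08), bib `Markman2025SecantWeil` — UNREFEREED PREPRINT. Pages/lines = PyMuPDF lines
of the public v2 PDF (sha256/16 `8155aa33870069b8`), read at seat lit-w-markman g14 (pub-hsemireg LIT-W, 2026-08-23;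
sheet `LOCATOR-SHEET-MARKMAN.md` §43; the four quotation windows below were read BY EYE on 160-dpi renders
`HOME/lit/Markman-renders-litw-markman-g14/r_mar25_v2_p04_eq123_tau.png`, `…p64_bottom_sec85.png`, `…p65_top_851.png`,
`…p68_R853_R854.png` — the text layer flattens the exponents `(k+t)(k+t−1)/2` etc. onto separate lines). Companions: `ContractionExpConjugation.lean` (Lemma 9.3.8 / the unipotent matrix
(9.3.4) of `⌟exp(−λ)`), `ObstructionKernelTransport.lean` (Cor. 8.3.12's `K ∩ [H²(𝒪_X) ⊕ H⁰(∧²TX)] = (0)` on `X`),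
`SpinorSecantDimensionCounts.lean` (`dim ker(ob_F) = 9 = n²`).

## What is printed (verbatim, v2)
* (1.2.3), p. 4 L8–13: «`(s, t)_S := ∫_X τ(s) ∪ t`, where the main anti-automorphism `τ` acts via multiplication by
  `(−1)^{i(i−1)/2}` on `H^i(X, ℤ)`.» (Also [Mar25c] arXiv:2509.23079v1 (10.1.5), p. 32: «`τ : H^*(X, ℤ) → H^*(X, ℤ)` acts on
  `H^i(X, ℤ)` by multiplication by `(−1)^{i(i−1)/2}`.»)
* §8.5, p. 64 L93 – p. 65 L31: «The algebra `HT^*(X)` acts on its module `H^*(X, ℂ) := ⊕ H^{p,q}(X)` and embeds in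
  `End(H^*(X, ℂ))`. Given `α ∈ HT^*(X)` denote by `e_α ∈ End(H^*(X, ℂ))` the corresponding endomorphism. Let `τ` be the
  involution in (1.2.3). If `α` is an element of `H^i(∧^j TX)` and `x` is a class in `H^k(X, ℂ)`, then `e_α(x)` belongs
  to `H^{k+i−j}(X, ℂ)`. Set `t := i − j`. We have
  `(τ ∘ e_α ∘ τ)(x) = (−1)^{(k+t)(k+t−1)/2} (−1)^{k(k−1)/2} e_α(x) = (−1)^{kt + t(t−1)/2} e_α(x)`.
  In particular, for `k` even, we have `(τ ∘ e_α ∘ τ)(x) = (−1)^{t(t−1)/2} e_α(x)`. In particular,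
  `(τ ∘ e_α ∘ τ)(ch(F)) = (−1)^{t(t−1)/2} e_α(ch(F))`. Let `(•)* : HT^*(X) → HT^*(X)` act on `H^i(∧^j TX)` by
  multiplication by `(−1)^{(i−j)(i−j−1)/2}`. We get (8.5.1) `(τ ∘ e_α ∘ τ)(ch(F)) = e_{α*}(ch(F))`. Recall that
  `τ(ch(F)) = ch(F^∨)`. In particular, `e_{α*}` annihilates `ch(F^∨)`, if and only if `e_α` annihilates `ch(F)`. For
  `(α, β, γ) ∈ HT²(X) = H²(𝒪_X) ⊕ H¹(TX) ⊕ H⁰(∧²TX)` we have `(α, β, γ)* = (−α, β, −γ)`.»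
* REMARK 8.5.3, p. 68 L29–41: «The image of the diagonal embedding in `HT²(X × X)`, of the kernel in `HT²(X)` of `ob_{F₁}`,
  is mapped via `Φ^{HT} ∘ (id ⊗ (•)*)` into a subspace of `H²(𝒪_{X×X̂}) ⊕ H¹(T(X × X̂))`, which projects onto the tangent
  space in `H¹(T(X × X̂))` of the moduli space of abelian varieties of Weil type. This will follow from Lemma 9.3.9, which
  shows that contraction with `exp(−c₁(E)/rank(E))` induces an automorphism of `HT²(X × X̂)` mapping the kernel of `ob_E`
  into the subspace of `H¹(T(X × X̂))` tangent to the moduli space of abelian varieties of Weil type. The above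
  automorphism is unipotent, leaving each of `H²(𝒪_{X×X̂}) ⊕ H¹(T(X × X̂))` and `H²(𝒪_{X×X̂})` invariant and inducing the
  identity on the graded summand. Hence, the automorphism restricts to the kernel of `ob_E` as the projection to
  `H¹(T(X × X̂))`.»
* REMARK 8.5.4, p. 68 L42–49: «… The cohomological action of `ι` corresponds to the element in the center of `Spin(V)`
  acting as the isentity [sic] on `S⁺` and by multiplication by `−1` on `V` and `S⁻`. It acts on `HT^{ev}(X)`, and so on
  `HT²(X)`, as the identity and on `HT^{odd}(X)` by multiplication by `−1`.»

## What this file proves (theorems only; NO named fact, NO sorry)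
* SIGNS (`Int.negOnePow`, exponents in `ℤ` — `t = i − j` may be negative): `tauExp n := n(n−1)/2` is an exact half
  (`two_mul_tauExp`); `tauExp_add` — the EXACT identity `(k+t)(k+t−1)/2 = k(k−1)/2 + kt + t(t−1)/2` behind the printed
  second equality; `sign_rule` — `(−1)^{(k+t)(k+t−1)/2}·(−1)^{k(k−1)/2} = (−1)^{kt + t(t−1)/2}` for ALL integers `k, t`;
  `sign_rule_even` — `= (−1)^{t(t−1)/2}` for even `k` («In particular, for `k` even …»; `ch(F)` is even); `star_HT2` —
  on `HT²(X) = H²(𝒪_X) ⊕ H¹(TX) ⊕ H⁰(∧²TX)` (`t = 2, 0, −2`) the factors are `−1, +1, −1`, i.e. `(α, β, γ)* = (−α, β, −γ)`;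
  `tau_even_degree` — on `H^{2p}` the sign `(−1)^{2p(2p−1)/2}` is `(−1)^p` (the familiar sign in `ch(F^∨)_p = (−1)^p ch_p(F)`
  behind «`τ(ch(F)) = ch(F^∨)`»); `sign_sq` — the sign operators square to `1`; `iota_sign` — Remark 8.5.4's `ι` as the sign `(−1)^m` on total
  degree `m`: `+1` on `HT^{ev}` (so on `HT²`), `−1` on `HT^{odd}`; `tau_signs_small` — the signs of `τ` on `H^0, …, H^6`.
* REMARK 8.5.3's last two sentences as linear algebra on `V = A ⊕ B ⊕ C` (`= H²(𝒪) ⊕ H¹(T) ⊕ H⁰(∧²T)` of `X × X̂`):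
  `unipotent_restricts_to_projection` — an endomorphism `u` that induces the identity on the top graded piece `C` and on
  the middle piece `B` of the flag `A ⊂ A ⊕ B ⊂ V`, and maps a subspace `K` into `B`, agrees on `K` with the projection
  to `B`; `projB_injOn_of_injective` — since the printed `u` is an AUTOMORPHISM (injective), that projection is then
  injective on `K`, i.e. `K ∩ [A ⊕ C] = 0` on `X × X̂` (the same shape of statement as Cor. 8.3.12's
  «`K ∩ [H²(𝒪_X) ⊕ H⁰(∧²TX)] = (0)`» on `X`, here DERIVED from unipotence + injectivity); `finrank_projB_eq_of_disjoint` —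
  hence `dim proj_B(K) = dim K` — the dimension bookkeeping under «projects onto the tangent space» (`dim ker(ob_E)`
  and the tangent space both `9`-dimensional at `n = 3`, Thm 1.4.1 (5); the INCLUSION is Lemma 9.3.9, by value).

## Inputs BY VALUE and honest framing
That `e_α` shifts degree by `t = i − j`, that `τ(ch(F)) = ch(F^∨)`, Lemma 9.3.9, the inclusion of `u(ker ob_E)` in the
Weil-type tangent space, and every identification of `A, B, C` with Hodge pieces are inputs; the kernel adds only the
parity arithmetic and the two linear-algebra sentences. Nothing here says that any sheaf is semiregular or deforms, and
nothing here bears on HC / HC_CM / HC_AV.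
-/

namespace Literature.AlgebraicGeometry.Markman2025

namespace TauSign

/-- The exponent `n(n−1)/2` of the main anti-automorphism `τ` on `H^n` ((1.2.3), p. 4 L13: «`τ` acts via multiplication
by `(−1)^{i(i−1)/2}` on `H^i(X, ℤ)`»), as an integer (exact: `n(n−1)` is even).
[cite: Markman2025SecantWeil, §1.2 (1.2.3) (v2 p. 4 L8–13)] -/
def tauExp (n : ℤ) : ℤ := n * (n - 1) / 2

/-- `n(n−1)` is even, so `tauExp` is an exact half: `2 · tauExp n = n(n−1)`.
[cite: Markman2025SecantWeil, §1.2 (1.2.3) (v2 p. 4 L13)] -/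
theorem two_mul_tauExp (n : ℤ) : 2 * tauExp n = n * (n - 1) := by
  unfold tauExp
  have h : 2 ∣ n * (n - 1) := by
    have := Int.even_mul_pred_self n
    exact even_iff_two_dvd.mp this
  omega

/-- **[M] §8.5, p. 65 L5–13, the second «=»**: the EXACT identity of exponents
`(k+t)(k+t−1)/2 = k(k−1)/2 + kt + t(t−1)/2` (all three halves exact), from which
`(k+t)(k+t−1)/2 + k(k−1)/2 ≡ kt + t(t−1)/2 (mod 2)`. [cite: Markman2025SecantWeil, §8.5 (v2 p. 65 L3–13)] -/
theorem tauExp_add (k t : ℤ) : tauExp (k + t) = tauExp k + k * t + tauExp t := by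
  have h1 := two_mul_tauExp (k + t)
  have h2 := two_mul_tauExp k
  have h3 := two_mul_tauExp t
  nlinarith [h1, h2, h3]

/-- **[M] §8.5, p. 65 L5–13 — THE SIGN RULE**: for every integer `k` (degree of `x`) and `t = i − j` (degree shift of
`e_α`, possibly negative), `(−1)^{(k+t)(k+t−1)/2} · (−1)^{k(k−1)/2} = (−1)^{kt + t(t−1)/2}` — the printed
«`(τ ∘ e_α ∘ τ)(x) = (−1)^{(k+t)(k+t−1)/2} (−1)^{k(k−1)/2} e_α(x) = (−1)^{kt+t(t−1)/2} e_α(x)`» as an identity of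
signs (`Int.negOnePow`). [cite: Markman2025SecantWeil, §8.5 (v2 p. 65 L3–13)] -/
theorem sign_rule (k t : ℤ) : (tauExp (k + t)).negOnePow * (tauExp k).negOnePow = (k * t + tauExp t).negOnePow := by
  rw [← Int.negOnePow_add, tauExp_add,
    show tauExp k + k * t + tauExp t + tauExp k = (k * t + tauExp t) + 2 * tauExp k by ring,
    Int.negOnePow_add, Int.negOnePow_two_mul, mul_one]

/-- **[M] §8.5, p. 65 L14–21**: «In particular, for `k` even, we have `(τ ∘ e_α ∘ τ)(x) = (−1)^{t(t−1)/2} e_α(x)`»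
(and so for `x = ch(F)`, which lives in even degrees). [cite: Markman2025SecantWeil, §8.5 (v2 p. 65 L14–21)] -/
theorem sign_rule_even (k t : ℤ) (hk : Even k) :
    (tauExp (k + t)).negOnePow * (tauExp k).negOnePow = (tauExp t).negOnePow := by
  rw [sign_rule, Int.negOnePow_add]
  obtain ⟨a, rfl⟩ := hk
  rw [show (a + a) * t = 2 * (a * t) by ring, Int.negOnePow_two_mul, one_mul]

/-- **[M] §8.5, p. 65 L22–31**: «Let `(•)* : HT^*(X) → HT^*(X)` act on `H^i(∧^j TX)` by multiplication by
`(−1)^{(i−j)(i−j−1)/2}`. … For `(α, β, γ) ∈ HT²(X) = H²(𝒪_X) ⊕ H¹(TX) ⊕ H⁰(∧²TX)` we have `(α, β, γ)* = (−α, β, −γ)`.»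
— the three summands have `t = i − j = 2, 0, −2` and the factors are `(−1)^1 = −1`, `(−1)^0 = 1`, `(−1)^3 = −1`.
[cite: Markman2025SecantWeil, §8.5 (8.5.1) (v2 p. 65 L22–31)] -/
theorem star_HT2 :
    (tauExp (2 - 0)).negOnePow = -1 ∧ (tauExp (1 - 1)).negOnePow = 1 ∧ (tauExp (0 - 2)).negOnePow = -1 := by
  refine ⟨?_, ?_, ?_⟩ <;> decide

/-- `τ` on EVEN degrees: `(−1)^{2p(2p−1)/2} = (−1)^{p(2p−1)} = (−1)^p` — the sign on `H^{2p}` behind the printed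
«Recall that `τ(ch(F)) = ch(F^∨)`» (p. 65 L29; `ch_p(F^∨) = (−1)^p ch_p(F)` by value).
[cite: Markman2025SecantWeil, §8.5 (v2 p. 65 L29) and §1.2 (1.2.3) (p. 4 L13)] -/
theorem tau_even_degree (p : ℤ) : (tauExp (2 * p)).negOnePow = p.negOnePow := by
  have h : tauExp (2 * p) = p * (2 * p - 1) := by
    have := two_mul_tauExp (2 * p)
    nlinarith [this]
  rw [h, show p * (2 * p - 1) = p + 2 * (p * (p - 1)) by ring, Int.negOnePow_add, Int.negOnePow_two_mul, mul_one]

/-- `τ` on degrees `0, 1, 2, 3, 4, 5, 6` (an abelian threefold's `H^*`): signs `+, +, −, −, +, +, −` — period 4.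
[cite: Markman2025SecantWeil, §1.2 (1.2.3) (v2 p. 4 L13)] -/
theorem tau_signs_small :
    (List.range 7).map (fun i => ((tauExp i).negOnePow : ℤ)) = [1, 1, -1, -1, 1, 1, -1] := by
  decide

/-- Both sign operators are involutions on signs: `((−1)^{n(n−1)/2})² = 1` — consistent with «Let `τ` be the
involution in (1.2.3)» (p. 64 L95 – p. 65 L3) and with «the involution `id ⊗ (•)*`» (p. 65 L35).
[cite: Markman2025SecantWeil, §8.5 (v2 p. 64 L95 – p. 65 L3, p. 65 L35)] -/
theorem sign_sq (n : ℤ) : (tauExp n).negOnePow * (tauExp n).negOnePow = 1 := by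
  rw [← Int.negOnePow_add, ← two_mul, Int.negOnePow_two_mul]

/-- **[M] REMARK 8.5.4, p. 68 L46–49**: the involution `ι` «acts on `HT^{ev}(X)`, and so on `HT²(X)`, as the identity
and on `HT^{odd}(X)` by multiplication by `−1`» — as a sign `(−1)^m` on total degree `m`: `+1` for even `m` (in
particular `m = 2`), `−1` for odd `m`. [cite: Markman2025SecantWeil, Remark 8.5.4 (v2 p. 68 L42–49)] -/
theorem iota_sign (m : ℤ) :
    (Even m → m.negOnePow = 1) ∧ (Odd m → m.negOnePow = -1) ∧ (2 : ℤ).negOnePow = 1 :=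
  ⟨Int.negOnePow_even m, Int.negOnePow_odd m, by decide⟩

end TauSign

/-! ### Remark 8.5.3: a unipotent automorphism of a three-step graded space restricts to a subspace it maps into the
middle piece as the projection to the middle piece -/

namespace UnipotentProjection

variable {K : Type*} [Field K]
variable {A B C : Type*} [AddCommGroup A] [Module K A] [AddCommGroup B] [Module K B] [AddCommGroup C] [Module K C]

/-- **[M] REMARK 8.5.3, last two sentences (v2 p. 68 L36–41)**, on `V = A ⊕ B ⊕ C` (`A = H²(𝒪_{X×X̂})`,
`B = H¹(T(X × X̂))`, `C = H⁰(∧²T)`): let `u : V → V` leave `A ⊕ B` and `A` invariant and induce the identity on the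
graded pieces — here only the two consequences actually used are assumed, `hC` (identity on the top graded piece:
the `C`-component is unchanged) and `hB` (identity on the middle graded piece: for `v ∈ A ⊕ B` the `B`-component is
unchanged) —, and let `u` map the subspace `K` into `B` (`hK`, «mapping the kernel of `ob_E` into the subspace
`H¹(T(X × X̂))`», from Lemma 9.3.9, by value). Then «the automorphism restricts to the kernel of `ob_E` as the projection
to `H¹(T(X × X̂))`»: `u k = (0, k_B, 0)` for every `k ∈ K` (and `k_C = 0`).
[cite: Markman2025SecantWeil, Remark 8.5.3 (v2 p. 68 L29–41)] -/
theorem unipotent_restricts_to_projection (u : (A × B × C) →ₗ[K] (A × B × C)) (W : Submodule K (A × B × C))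
    (hC : ∀ v, (u v).2.2 = v.2.2) (hB : ∀ (a : A) (b : B), (u (a, b, 0)).2.1 = b)
    (hK : ∀ k ∈ W, (u k).1 = 0 ∧ (u k).2.2 = 0) (k : A × B × C) (hk : k ∈ W) :
    u k = (0, k.2.1, 0) ∧ k.2.2 = 0 := by
  obtain ⟨a, b, c⟩ := k
  obtain ⟨h1, h3⟩ := hK _ hk
  have hc : c = 0 := by
    have := hC (a, b, c)
    rw [h3] at this
    exact this.symm
  subst hc
  have h2 : (u (a, b, 0)).2.1 = b := hB a b
  refine ⟨?_, rfl⟩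
  ext <;> simp [h1, h2, h3]

/-- REMARK 8.5.3, continued: the printed `u` is an AUTOMORPHISM («induces an automorphism of `HT²(X × X̂)`»), so from
`u|_K = proj_B|_K` the projection to `B` is INJECTIVE on `K` — no non-zero vector of `K = ker(ob_E)` lies in
`A ⊕ C = H²(𝒪_{X×X̂}) ⊕ H⁰(∧²T)` (on `X × X̂`; compare the same shape of statement on `X` in Cor. 8.3.12, there proved from
the triangular matrix). [cite: Markman2025SecantWeil, Remark 8.5.3 (v2 p. 68 L33–41)] -/
theorem projB_injOn_of_injective (u : (A × B × C) →ₗ[K] (A × B × C)) (W : Submodule K (A × B × C))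
    (hu : Function.Injective u)
    (hC : ∀ v, (u v).2.2 = v.2.2) (hB : ∀ (a : A) (b : B), (u (a, b, 0)).2.1 = b)
    (hK : ∀ k ∈ W, (u k).1 = 0 ∧ (u k).2.2 = 0) :
    ∀ k ∈ W, k.2.1 = 0 → k = 0 := by
  intro k hk hb
  have h := (unipotent_restricts_to_projection u W hC hB hK k hk).1
  rw [hb] at h
  have h0 : u k = u 0 := by rw [h, map_zero]; rfl
  exact hu h0

/-- The dimension bookkeeping under «projects onto the tangent space» (Remark 8.5.3 with Thm. 1.4.1 (5): `ker(ob_E)` and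
the Weil-type tangent space are both `9`-dimensional at `n = 3`): if the projection of `K ⊂ A ⊕ B ⊕ C` to `B` kills no
non-zero vector of `K` (e.g. by `projB_injOn_of_injective`), then `dim proj_B(K) = dim K`. The printed INCLUSION of the
image in the tangent space (Lemma 9.3.9) and the two `9`'s are inputs by value.
[cite: Markman2025SecantWeil, Remark 8.5.3 (v2 p. 68 L29–41)] -/
theorem finrank_projB_eq_of_disjoint [FiniteDimensional K A] [FiniteDimensional K B] [FiniteDimensional K C]
    (W : Submodule K (A × B × C)) (hW : ∀ k ∈ W, k.2.1 = 0 → k = 0) :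
    Module.finrank K (W.map (LinearMap.fst K B C ∘ₗ LinearMap.snd K A (B × C))) = Module.finrank K W := by
  set p : (A × B × C) →ₗ[K] B := LinearMap.fst K B C ∘ₗ LinearMap.snd K A (B × C) with hp
  have hker : LinearMap.ker (p.domRestrict W) = ⊥ := by
    rw [LinearMap.ker_eq_bot']
    intro k hk0
    have : (k : A × B × C).2.1 = 0 := by simpa [hp] using hk0
    exact Subtype.ext (hW k k.2 this)
  have hinj : Function.Injective (p.domRestrict W) := LinearMap.ker_eq_bot.mp hker
  rw [← LinearMap.range_domRestrict, LinearMap.finrank_range_of_inj hinj]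

end UnipotentProjection

end Literature.AlgebraicGeometry.Markman2025
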